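import Summits.PneNP.PneNP.Theorems.ChebyshevTracialDesignGammaDirectionCentredDischarge
import Summits.PneNP.PneNP.Theorems.ChebyshevTracialDesignGammaDirectionReduction
import HarnessLib

/-!
# Cell pnp-psdrank, route `ChebyshevTracialDesign`: the γ-direction value bound with the centred inputs DISCHARGED — brick 134 made
# unconditional modulo the three smallness inequalities and the two floors (crux `TracialDecayExp20`, stmt-PneNP-19878)

Brick 142 (prover g28; MEMO-31 §3). Brick 134 (`…GammaDirectionConditional.gammaDirection_value_le_of_centred`) = brick 129 + brick 130 with the
centred-basis relative-smoothness hypotheses (hcentre), (hA), (hBm), (hC) left open. Brick 141 (`…GammaDirectionCentredDischarge`) discharges them on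
any integer window `B ⊆ [2D+4, 2s+1] ∩ {|y − (2s+1)|H|/n| < ε}` from: Lq's margins once at `(N₀−2, ε+8)`, brick 139's `k = 1` leg, the six
`lqConstants_le`-shaped comparisons, the variance floor `cV·law_1 ≤ A^m_1` and the window floor `LB ≤ law_1` on `B`, and the three smallness
inequalities `ε_A ≤ ¾`, `ε_B(m) ≤ ¼` (`0 ≤ m ≤ a`), `ε_C ≤ ¼`. This file is the three-line combination, exactly as brick 134 combined 129 and 130:

* **`gammaDirection_value_le_discharged`**: for an exact design (`t = 2s+1`, `T+4 ≤ t`, `2D+1 ≤ T`, …), a perfect matching `M`, a block `H` of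
  type `(a,b,d)` with `a ≥ 2`, every `0 ≤ ψ ≤ G`, every `|γ|,|λ|,|κ| ≤ 1`:
  `|PM|·Σ_U W(U,M)·ψ(|U∩H|)·(Σ_p u_p x_p x_{πp})² ≤ R₁₂₀ + R₇ + 12R′ + 2^{D+1}·G·(2n+3t)²·Σ_{y∈[0,t]∖B} Σ_{j≤D} law_{2j+1}(y)`
  with brick 129's remainders VERBATIM (in the `x`-smoothness family `X_k`, brick 132 discharges it by type).
WHAT IS LEFT for the exp form (brick 143): choose `B` = the integer window, bound the law tail off `B` (`ShellLawTail`), plug brick 132 for `X_k`,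
lit's `centredSq_law_ge_of_window_one` for `hV`, `shellLaw_one_window_lower` for `LB`, and eng's numerics `gamma_bulk_numerics` (140c) +
`lqConstants_le` (140a) + `epsBC_numerics` (140b) + `epsA_numerics` (140d) for the margins and the three smallness inequalities; then the
`M`-average (brick 127 pattern). WHAT THIS FILE DOES NOT DO: those, anything on `TracialDecayExp20` itself, psd rank of P_PM(K_n), or P vs NP.
[cite: Rothvoss2017, §2 (PDF p. 6)] [cite: Agarwal2000DifferenceEquations, Thm. 1.8.5 (1.8.6), Remark 1.8.1 (1.8.8)] [cite: GriblingDelaatLaurent2019, §5]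
Stature: support/instrument (kernel lane, no defs, axioms standard; constants asymptotic only). Supports stmt-PneNP-19878.
-/

set_option linter.dupNamespace false -- `Summit.PneNP.PneNP.…`: summit = sub-problem (D-0017)

noncomputable section

namespace Summit.PneNP.PneNP.Theorems.ChebyshevTracialDesignGammaDirectionDischarged

open Finset Polynomial Literature.Barriers.PneNP Literature.Combinatorics.Optimization
open Literature.Combinatorics.Optimization.ShellStep
open Summit.PneNP.PneNP.Theorems.ChebyshevTracialDesignGammaDirectionReduction (abs_gammaDirection_value_add_newton_le)
open Summit.PneNP.PneNP.Theorems.ChebyshevTracialDesignGammaDirectionCentredDischarge (gammaProfile_newton_eval_zero_ge_discharged)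

variable {n : ℕ}

set_option maxHeartbeats 400000 in -- ×2 head-room: bricks 129 and 141 instantiated in one context
/-- **THE γ-DIRECTION VALUE BOUND, CENTRED INPUTS DISCHARGED (brick 142).** Hypotheses: brick 129's (design, `ψ`, direction, `m ≥ 3`, the
`x`-smoothness family `X_k`) and brick 141's (types, margins, the `k = 1` leg, the `lqConstants_le`-shaped comparisons, the window set `B`, the two
floors, the three smallness inequalities), `t = 2s+1`. Conclusion: brick 134's, verbatim.
[cite: Rothvoss2017, §2 (PDF p. 6)] [cite: Agarwal2000DifferenceEquations, Thm. 1.8.5 (1.8.6), Remark 1.8.1 (1.8.8)] -/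
theorem gammaDirection_value_le_discharged {t T D : ℕ} {Bv : ℝ} {C : Finset ℕ} {w : ℕ → ℝ}
    (hdes : IsExactDesign n t T D Bv C w) (hDT : 2 * D + 1 ≤ T) (hT4 : T + 4 ≤ t) (h4t : 2 * (D + 1) + 4 ≤ t)
    (M : PMatch n) (H : Finset (Fin n)) (ψ : ℤ → ℝ) {G : ℝ} (hG0 : 0 ≤ G)
    (hψ0 : ∀ x ∈ Icc (0 : ℤ) (t : ℤ), 0 ≤ ψ x) (hψG : ∀ x ∈ Icc (0 : ℤ) (t : ℤ), ψ x ≤ G)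
    (gam lam kap : ℝ) (hgam : |gam| ≤ 1) (hlam : |lam| ≤ 1) (hkap : |kap| ≤ 1)
    {m : ℕ} (hm : 3 ≤ m) (hmn : m + 4 * (D + 1) + 4 ≤ n) (X : ℕ → ℝ) (hX0 : ∀ k, 0 ≤ X k)
    (hX : ∀ k, k ≤ D + 1 → ∀ r s : ℕ, r ≤ 2 → r ≤ s → s ≤ 2 * r → ∀ c' : ℕ, c' + 2 * k ≤ T →
      ∀ S' : Finset (Fin n), (∀ u ∈ S', M.2.partner u ∈ S') → S'.card + 4 * k + 2 * r = n →
      ∑ x ∈ Icc (0 : ℤ) ((t - s : ℕ) : ℤ),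
        |nab2^[k] (fun c x => shellLaw M.2.partner S' H (t - s - 2 * k) c x : Profile) c' x| ≤ X k)
    {s a a₂ b d N₀ N₁ N₂ s₁ s₂ r : ℕ} (ht : t = 2 * s + 1)
    (hN01 : N₁ + 1 = N₀) (hN12 : N₂ + 1 = N₁) (hs₁ : s₁ + 1 = s) (hs₂ : s₂ + 1 = s₁) (hr : r + 3 = s) (haa : a₂ + 2 = a)
    (ha : (reps M.2.partner (vAA M.2.partner univ H)).card = a)
    (hb : (reps M.2.partner (vBH M.2.partner univ H ∪ vBN M.2.partner univ H)).card = b)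
    (hd : (reps M.2.partner (vDD M.2.partner univ H)).card = d) (hN : a + b + d = N₀) (hn : n = 2 * N₀)
    {β : ℝ} (hβ : 0 < β) (hβ1 : β ≤ 1 / 4) (hD1 : 1 ≤ D) (hDN : 16 * D + 16 ≤ N₂)
    (hbβ : β * N₀ + 2 * D + 1 ≤ b) (hdβ : β * N₀ + 2 * D + 1 ≤ d)
    (hs : β * N₂ + D ≤ s₂) (hs' : 8 * (s : ℝ) ≤ (4 + β) * ((N₀ : ℝ) - 2 * D)) (hDs : D ≤ s₂) (hsn : 2 * s + 2 * D + 2 ≤ n)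
    {ε L : ℝ} (h2D : 2 * (D : ℝ) ≤ L) (hLN : 2 * L ≤ N₂)
    (hq1 : L + D + (ε + 8 + 14 * D + 1) ≤ β ^ 2 * N₂)
    (hq2 : L + D + (ε + 8 + 14 * D + 1) + 3 ≤ β * ((N₂ : ℝ) - 2 * D) / 8)
    (hq3 : 2 * (L + D + 1) ≤ (β ^ 2 / 8) ^ 2 * (β * ((N₂ : ℝ) - 2 * D)))
    (hq4 : 4 ≤ β * ((N₂ : ℝ) - 2 * D))
    (hq5 : (D : ℝ) * (1 + 8 * (L + D + 1) / ((β ^ 2 / 8) ^ 4 * (β * ((N₂ : ℝ) - 2 * D)))) ≤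
      (β ^ 2 / 8) ^ 4 * (β * ((N₂ : ℝ) - 2 * D)))
    {Lx : ℝ} (h2Lx : 2 ≤ Lx) (hLxN : Lx - 2 ≤ 2 * ((N₀ : ℝ) - 2))
    (hLx1 : Lx + 1 + (ε + 15) ≤ β * ((r : ℝ) + 2)) (hLx2 : Lx + 1 + (ε + 15) + 3 ≤ β * ((N₀ : ℝ) - 2) / 8)
    (hwin : 2 * (Lx + 1 + 1) ≤ (β ^ 2 / 8) ^ 2 * (β * ((N₀ : ℝ) - 2))) (hN4 : 4 ≤ β * ((N₀ : ℝ) - 2))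
    (hkV : (1 : ℝ) * (1 + 8 * (Lx + 1 + 1) / ((β ^ 2 / 8) ^ 4 * (β * ((N₀ : ℝ) - 2)))) ≤
      (β ^ 2 / 8) ^ 4 * (β * ((N₀ : ℝ) - 2)))
    {E Far : ℝ} (hE0 : 0 ≤ E) (hFar0 : 0 ≤ Far)
    (hE : (((1 + 8 * (Lx + 1 + 1) / ((β ^ 2 / 8) ^ 4 * (β * ((N₀ : ℝ) - 2)))) *
            (8 * (Lx + 1 + 1) / ((β ^ 2 / 8) ^ 4 * (β * ((N₀ : ℝ) - 2))) +
              2 * Real.sqrt 192 * Real.sqrt (2 * (2 * (1 : ℝ) + 1) *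
                (1 + 8 * (Lx + 1 + 1) / ((β ^ 2 / 8) ^ 4 * (β * ((N₀ : ℝ) - 2)))) /
                  ((β ^ 2 / 8) ^ 4 * (β * ((N₀ : ℝ) - 2)))))) ^ (2 * 1) *
          (1 + 4 * (Real.sqrt ((N₀ : ℝ) - 2) + 1) / 3 *
            (2 * Real.sqrt 192 * Real.sqrt (2 * (2 * (1 : ℝ) + 1) *
              (1 + 8 * (Lx + 1 + 1) / ((β ^ 2 / 8) ^ 4 * (β * ((N₀ : ℝ) - 2)))) /
                ((β ^ 2 / 8) ^ 4 * (β * ((N₀ : ℝ) - 2))))))) ≤ E)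
    (hFar : (4 : ℝ) ^ 1 * Real.exp (-((Lx - 2 * 1) ^ 2 / (4 * ((N₀ : ℝ) - 2)))) ≤ Far)
    {Γ q : ℝ}
    (hΓ₀ : (1 + 4 * (Real.sqrt N₀ + 1) / 3 *
          (2 * Real.sqrt 192 * Real.sqrt (2 * (2 * (D : ℝ) + 1) * (1 + 8 * (L + D + 1) / ((β ^ 2 / 8) ^ 4 * (β * ((N₀ : ℝ) - 2 * D)))) /
            ((β ^ 2 / 8) ^ 4 * (β * ((N₀ : ℝ) - 2 * D)))))) ≤ Γ)
    (hΓ₁ : (1 + 4 * (Real.sqrt N₁ + 1) / 3 *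
          (2 * Real.sqrt 192 * Real.sqrt (2 * (2 * (D : ℝ) + 1) * (1 + 8 * (L + D + 1) / ((β ^ 2 / 8) ^ 4 * (β * ((N₁ : ℝ) - 2 * D)))) /
            ((β ^ 2 / 8) ^ 4 * (β * ((N₁ : ℝ) - 2 * D)))))) ≤ Γ)
    (hΓ₂ : (1 + 4 * (Real.sqrt N₂ + 1) / 3 *
          (2 * Real.sqrt 192 * Real.sqrt (2 * (2 * (D : ℝ) + 1) * (1 + 8 * (L + D + 1) / ((β ^ 2 / 8) ^ 4 * (β * ((N₂ : ℝ) - 2 * D)))) /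
            ((β ^ 2 / 8) ^ 4 * (β * ((N₂ : ℝ) - 2 * D)))))) ≤ Γ)
    (hq₀ : (4 * ((1 + 8 * (L + D + 1) / ((β ^ 2 / 8) ^ 4 * (β * ((N₀ : ℝ) - 2 * D)))) *
          (8 * (L + D + 1) / ((β ^ 2 / 8) ^ 4 * (β * ((N₀ : ℝ) - 2 * D))) +
            2 * Real.sqrt 192 * Real.sqrt (2 * (2 * (D : ℝ) + 1) * (1 + 8 * (L + D + 1) / ((β ^ 2 / 8) ^ 4 * (β * ((N₀ : ℝ) - 2 * D)))) /
            ((β ^ 2 / 8) ^ 4 * (β * ((N₀ : ℝ) - 2 * D)))))) ^ 2 / (3 * β)) ≤ q)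
    (hq₁ : (4 * ((1 + 8 * (L + D + 1) / ((β ^ 2 / 8) ^ 4 * (β * ((N₁ : ℝ) - 2 * D)))) *
          (8 * (L + D + 1) / ((β ^ 2 / 8) ^ 4 * (β * ((N₁ : ℝ) - 2 * D))) +
            2 * Real.sqrt 192 * Real.sqrt (2 * (2 * (D : ℝ) + 1) * (1 + 8 * (L + D + 1) / ((β ^ 2 / 8) ^ 4 * (β * ((N₁ : ℝ) - 2 * D)))) /
            ((β ^ 2 / 8) ^ 4 * (β * ((N₁ : ℝ) - 2 * D)))))) ^ 2 / (3 * β)) ≤ q)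
    (hq₂ : (4 * ((1 + 8 * (L + D + 1) / ((β ^ 2 / 8) ^ 4 * (β * ((N₂ : ℝ) - 2 * D)))) *
          (8 * (L + D + 1) / ((β ^ 2 / 8) ^ 4 * (β * ((N₂ : ℝ) - 2 * D))) +
            2 * Real.sqrt 192 * Real.sqrt (2 * (2 * (D : ℝ) + 1) * (1 + 8 * (L + D + 1) / ((β ^ 2 / 8) ^ 4 * (β * ((N₂ : ℝ) - 2 * D)))) /
            ((β ^ 2 / 8) ^ 4 * (β * ((N₂ : ℝ) - 2 * D)))))) ^ 2 / (3 * β)) ≤ q)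
    (hqh : q ≤ 1 / 2)
    (B : Finset ℤ) (hB : ∀ y ∈ B, (2 * (D : ℤ) + 4 ≤ y ∧ y ≤ ((2 * s + 1 : ℕ) : ℤ)) ∧ |(y : ℝ) - (2 * (s : ℝ) + 1) * H.card / n| < ε)
    {cV LB : ℝ} (hcV : 0 < cV) (hLB : 0 < LB)
    (hV : ∀ y ∈ B, ∀ m : ℝ, cV * shellLaw M.2.partner univ H (2 * s + 1) 1 y ≤
      (∑ U ∈ ((shell M.2.partner (2 * s + 1) 1).filter fun U => ((U ∩ H).card : ℤ) = y), (((((reps M.2.partner (vAA M.2.partner univ H)).filter fun v => v ∈ U ∧ M.2.partner v ∈ U).card : ℕ) : ℝ) - m) ^ 2) /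
        ((shell M.2.partner (2 * s + 1) 1).card : ℝ))
    (hLBl : ∀ y ∈ B, LB ≤ shellLaw M.2.partner univ H (2 * s + 1) 1 y)
    (hεA : ((E * ((n : ℝ) * ((n : ℝ) - 2) / ((2 * (r : ℝ) + 6) * ((n : ℝ) - 2 * r - 8))) / 4 + 1 / ((r : ℝ) + 1)) +
          ((E * ((n : ℝ) * ((n : ℝ) - 2) / ((2 * (r : ℝ) + 6) * ((n : ℝ) - 2 * r - 8))) / 4 * (2 * (a : ℝ) ^ 2 / ((r : ℝ) + 1) + (2 * (a : ℝ) + 1) * a / ((r : ℝ) + 2)) +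
            (2 * (a : ℝ) + 1) * ((r : ℝ) + 3) / (2 * ((r : ℝ) + 2) * ((r : ℝ) + 1)) *
              ((a : ℝ) * (4 * Γ * q + (2 + 4 * Γ * q) / (2 * (r : ℝ) + 6))) +
            (a : ℝ) * (2 * (a : ℝ) + r + 3) / (2 * ((r : ℝ) + 2) * ((r : ℝ) + 1)) * (1 + 2 * Γ * q)) +
            (D : ℝ) * (2 * Γ * q ^ 2 * (a : ℝ) ^ 2 + 8 * (D : ℝ) * Γ * q * (a : ℝ) ^ 2 / (2 * (r : ℝ) + 6) +
            32 * (D : ℝ) ^ 2 * Γ * (a : ℝ) ^ 2 / ((2 * (r : ℝ) + 6) * (2 * (r : ℝ) + 4)) +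
            (2 * (a : ℝ) + 1) * a * (Γ * q ^ 2 + 4 * (D : ℝ) * Γ * q / (2 * (r : ℝ) + 6)))) / cV +
          ((((2 * (a : ℝ) + 1) * ((r : ℝ) + 3) / (2 * ((r : ℝ) + 2) * ((r : ℝ) + 1)) * (16 * (a : ℝ) / 3) +
            (a : ℝ) * (2 * (a : ℝ) + r + 3) / (2 * ((r : ℝ) + 2) * ((r : ℝ) + 1)) * (8 / 3)) +
              (D : ℝ) * (4 / 3 : ℝ) ^ D *
            ((a : ℝ) ^ 2 * ((2 * (r : ℝ) + 6) * (2 * (r : ℝ) + 4) / ((n : ℝ) * ((n : ℝ) - 2)) + 8 * (D : ℝ) * (2 * (r : ℝ) + 4) / ((n : ℝ) * ((n : ℝ) - 2)) +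
                32 * (D : ℝ) ^ 2 / ((n : ℝ) * ((n : ℝ) - 2)) + 1) +
              (2 * (a : ℝ) + 1) * a * ((2 * (r : ℝ) + 6 + 4 * D) / (n : ℝ)))) * Real.exp (-((L - 2 * D) ^ 2 / (4 * N₀))) +
            ((((r : ℝ) + 2 + a) ^ 2 + 2 * ((r : ℝ) + 2) ^ 2 / ((r : ℝ) + 1) + (2 * (a : ℝ) + 1)) / 4) * Far) / (LB * cV)) ≤ 3 / 4)
    (hεB : ∀ m : ℝ, 0 ≤ m → m ≤ a →
      (m * (Γ * (2 * q + 3 * D / s) + 2 * Γ * q) +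
          (D : ℝ) * (4 / 3 : ℝ) ^ D * ((2 * (s : ℝ) / n + 4 * D / n) * ((a : ℝ) * Real.exp (-((L - 2 * D) ^ 2 / (4 * N₀)))) + m * Real.exp (-((L - 2 * D) ^ 2 / (4 * N₀)))) / LB) /
        Real.sqrt cV ≤ 1 / 4)
    (hεC : (2 * Γ * q + (D : ℝ) * (4 / 3 : ℝ) ^ D * Real.exp (-((L - 2 * D) ^ 2 / (4 * N₀))) / LB) ≤ 1 / 4) :
    (Fintype.card (PMatch n) : ℝ) * ∑ U : OddSet n, levelWeight n t C w U M *
        (ψ ((U.1 ∩ H).card : ℤ) *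
          (∑ p : Fin n, (gam * (if (p ∈ H ∧ M.2.partner p ∈ H) then (1 : ℝ) else 0) +
              (lam * ((if (p ∈ H ∧ M.2.partner p ∈ H) then (1 : ℝ) else 0) -
                (if (p ∉ H ∧ M.2.partner p ∉ H) then (1 : ℝ) else 0)) + (lam + kap))) *
            ((if p ∈ U.1 then (1 : ℝ) else 0) * (if M.2.partner p ∈ U.1 then (1 : ℝ) else 0))) ^ 2) ≤
      -- R₁₂₀ (brick 120)
      (-- R₀
      Bv * ((((T - 1) / 2).choose (D + 1) : ℕ) : ℝ) *
          ((9 * (t : ℝ) ^ 2 * G) * (((m : ℝ) / (4 * ((m : ℝ) - 2))) ^ (D + 1) * X (D + 1))) +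
      -- 2 R₁
      2 * ((2 * (D : ℝ) + 1) * ((((2 * D).choose D : ℕ) : ℝ) / (4 : ℝ) ^ D) *
            ((3 * (t : ℝ) * G) * (((m : ℝ) / (4 * ((m : ℝ) - 2))) ^ D * X D)) +
          Bv * ((((T - 1) / 2).choose (D + 1) : ℕ) : ℝ) *
            ((T : ℝ) * ((3 * (t : ℝ) * G) * (((m : ℝ) / (4 * ((m : ℝ) - 2))) ^ (D + 1) * X (D + 1))) +
              2 * ((D : ℝ) + 1) * ((3 * (t : ℝ) * G) * (((m : ℝ) / (4 * ((m : ℝ) - 2))) ^ D * X D)))) +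
      -- R₂
      ((2 * (D : ℝ) + 1) * ((((2 * D).choose D : ℕ) : ℝ) / (4 : ℝ) ^ D) *
          ((T : ℝ) * (G * (((m : ℝ) / (4 * ((m : ℝ) - 2))) ^ D * X D)) +
            2 * (D : ℝ) * (G * (((m : ℝ) / (4 * ((m : ℝ) - 2))) ^ (D - 1) * X (D - 1)))) +
        Bv * ((((T - 1) / 2).choose (D + 1) : ℕ) : ℝ) *
          ((T : ℝ) * ((T : ℝ) * (G * (((m : ℝ) / (4 * ((m : ℝ) - 2))) ^ (D + 1) * X (D + 1))) +
              2 * ((D : ℝ) + 1) * (G * (((m : ℝ) / (4 * ((m : ℝ) - 2))) ^ D * X D))) +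
            2 * ((D : ℝ) + 1) * ((T : ℝ) * (G * (((m : ℝ) / (4 * ((m : ℝ) - 2))) ^ D * X D)) +
              2 * (D : ℝ) * (G * (((m : ℝ) / (4 * ((m : ℝ) - 2))) ^ (D - 1) * X (D - 1)))))) +
      -- 4 R₃
      4 * ((2 * (D : ℝ) + 1) * ((((2 * D).choose D : ℕ) : ℝ) / (4 : ℝ) ^ D) *
            (((H.card : ℝ) / n) * ((3 * (t : ℝ) * G) * (((m : ℝ) / (4 * ((m : ℝ) - 2))) ^ D * X D))) +
          Bv * ((((T - 1) / 2).choose (D + 1) : ℕ) : ℝ) *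
            ((T : ℝ) * (((H.card : ℝ) / n) * ((3 * (t : ℝ) * G) *
                (((m : ℝ) / (4 * ((m : ℝ) - 2))) ^ (D + 1) * X (D + 1)))) +
              2 * ((D : ℝ) + 1) * (((H.card : ℝ) / n) * ((3 * (t : ℝ) * G) *
                (((m : ℝ) / (4 * ((m : ℝ) - 2))) ^ D * X D))))) +
      -- 4 R₄
      4 * ((2 * (D : ℝ) + 1) * ((((2 * D).choose D : ℕ) : ℝ) / (4 : ℝ) ^ D) *
            ((T : ℝ) * (((H.card : ℝ) / n) * (G * (((m : ℝ) / (4 * ((m : ℝ) - 2))) ^ D * X D))) +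
              2 * (D : ℝ) * (((H.card : ℝ) / n) * (G * (((m : ℝ) / (4 * ((m : ℝ) - 2))) ^ (D - 1) * X (D - 1))))) +
          Bv * ((((T - 1) / 2).choose (D + 1) : ℕ) : ℝ) *
            ((T : ℝ) * ((T : ℝ) * (((H.card : ℝ) / n) * (G * (((m : ℝ) / (4 * ((m : ℝ) - 2))) ^ (D + 1) * X (D + 1)))) +
                2 * ((D : ℝ) + 1) * (((H.card : ℝ) / n) * (G * (((m : ℝ) / (4 * ((m : ℝ) - 2))) ^ D * X D)))) +
              2 * ((D : ℝ) + 1) * ((T : ℝ) * (((H.card : ℝ) / n) * (G * (((m : ℝ) / (4 * ((m : ℝ) - 2))) ^ D * X D))) +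
                2 * (D : ℝ) * (((H.card : ℝ) / n) * (G * (((m : ℝ) / (4 * ((m : ℝ) - 2))) ^ (D - 1) * X (D - 1))))))) +
      -- 4 R₅
      4 * ((2 * (D : ℝ) + 1) * ((((2 * D).choose D : ℕ) : ℝ) / (4 : ℝ) ^ D) *
            (((H.card : ℝ) / n) * (G * (((m : ℝ) / (4 * ((m : ℝ) - 2))) ^ D * X D))) +
          Bv * ((((T - 1) / 2).choose (D + 1) : ℕ) : ℝ) *
            ((T : ℝ) * (((H.card : ℝ) / n) * (G * (((m : ℝ) / (4 * ((m : ℝ) - 2))) ^ (D + 1) * X (D + 1)))) +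
              2 * ((D : ℝ) + 1) * (((H.card : ℝ) / n) * (G * (((m : ℝ) / (4 * ((m : ℝ) - 2))) ^ D * X D))))) +
      -- 4 R₆
      4 * ((2 * (D : ℝ) + 1) * ((((2 * D).choose D : ℕ) : ℝ) / (4 : ℝ) ^ D) *
            (((H.card : ℝ) ^ 2 / ((n : ℝ) * ((n : ℝ) - 2))) * (G * ((T : ℝ) * (((m : ℝ) / (4 * ((m : ℝ) - 2))) ^ D * X D) +
              2 * (D : ℝ) * (((m : ℝ) / (4 * ((m : ℝ) - 2))) ^ (D - 1) * X (D - 1))))) +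
          Bv * ((((T - 1) / 2).choose (D + 1) : ℕ) : ℝ) *
            ((T : ℝ) * (((H.card : ℝ) ^ 2 / ((n : ℝ) * ((n : ℝ) - 2))) *
                (G * ((T : ℝ) * (((m : ℝ) / (4 * ((m : ℝ) - 2))) ^ (D + 1) * X (D + 1)) +
                  2 * ((D : ℝ) + 1) * (((m : ℝ) / (4 * ((m : ℝ) - 2))) ^ D * X D)))) +
              2 * ((D : ℝ) + 1) * (((H.card : ℝ) ^ 2 / ((n : ℝ) * ((n : ℝ) - 2))) *
                (G * ((T : ℝ) * (((m : ℝ) / (4 * ((m : ℝ) - 2))) ^ D * X D) +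
                  2 * (D : ℝ) * (((m : ℝ) / (4 * ((m : ℝ) - 2))) ^ (D - 1) * X (D - 1)))))))) +
      -- R₇ (brick 129c with G₂ = 16tG, |α| ≤ 4)
      Bv * ((((T - 1) / 2).choose (D + 1) : ℕ) : ℝ) *
        (16 * (t : ℝ) * G * ((t : ℝ) * (((m : ℝ) / (4 * ((m : ℝ) - 2))) ^ (D + 1) * X (D + 1)) + 2 * ((D : ℝ) + 1) * (((m : ℝ) / (4 * ((m : ℝ) - 2))) ^ D * X D)) +
          4 * (G * ((t : ℝ) * ((t : ℝ) * (((m : ℝ) / (4 * ((m : ℝ) - 2))) ^ (D + 1) * X (D + 1)) + 2 * ((D : ℝ) + 1) * (((m : ℝ) / (4 * ((m : ℝ) - 2))) ^ D * X D)) +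
            2 * ((D : ℝ) + 1) * ((t : ℝ) * (((m : ℝ) / (4 * ((m : ℝ) - 2))) ^ D * X D) + 2 * (D : ℝ) * (((m : ℝ) / (4 * ((m : ℝ) - 2))) ^ (D - 1) * X (D - 1)))))) +
      -- 12 R′ (bricks 129b)
      12 * ((2 * (D : ℝ) + 1) * ((((2 * D).choose D : ℕ) : ℝ) / (4 : ℝ) ^ D) *
          ((t : ℝ) * (G * (((m : ℝ) / (4 * ((m : ℝ) - 2))) ^ D * X D)) +
            2 * (D : ℝ) * (G * (((m : ℝ) / (4 * ((m : ℝ) - 2))) ^ (D - 1) * X (D - 1)))) +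
        Bv * ((((T - 1) / 2).choose (D + 1) : ℕ) : ℝ) *
          ((T : ℝ) * ((t : ℝ) * (G * (((m : ℝ) / (4 * ((m : ℝ) - 2))) ^ (D + 1) * X (D + 1))) +
              2 * ((D : ℝ) + 1) * (G * (((m : ℝ) / (4 * ((m : ℝ) - 2))) ^ D * X D))) +
            2 * ((D : ℝ) + 1) * ((t : ℝ) * (G * (((m : ℝ) / (4 * ((m : ℝ) - 2))) ^ D * X D)) +
              2 * (D : ℝ) * (G * (((m : ℝ) / (4 * ((m : ℝ) - 2))) ^ (D - 1) * X (D - 1)))))) +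
      ((2 : ℝ) ^ (D + 1) * G * (2 * (n : ℝ) + 3 * (t : ℝ)) ^ 2 *
        ∑ x ∈ Icc (0 : ℤ) t \ B, ∑ j ∈ range (D + 1), shellLaw M.2.partner univ H t (2 * j + 1) x)
  := by
  subst ht
  have hG : ∀ x ∈ Icc (0 : ℤ) (((2 * s + 1 : ℕ) : ℕ) : ℤ), |ψ x| ≤ G := fun x hx => by
    rw [abs_of_nonneg (hψ0 x hx)]; exact hψG x hx
  have h129 := abs_gammaDirection_value_add_newton_le hdes hDT hT4 h4t M H ψ hG0 hG gam lam kap hgam hlam hkap hm hmn X hX0 hX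
  have h141 := gammaProfile_newton_eval_zero_ge_discharged M H hN01 hN12 hs₁ hs₂ hr haa ha hb hd hN hn hβ hβ1 hD1 hDN hbβ hdβ hs hs' hDs
    hsn h2D hLN hq1 hq2 hq3 hq4 hq5 h2Lx hLxN hLx1 hLx2 hwin hN4 hkV hE0 hFar0 hE hFar hΓ₀ hΓ₁ hΓ₂ hq₀ hq₁ hq₂ hqh ψ hψ0 hψG hgam hlam hkap
    B hB hcV hLB hV hLBl hεA hεB hεC
  have h := (abs_le.1 h129).2
  linarith only [h, h141]

end Summit.PneNP.PneNP.Theorems.ChebyshevTracialDesignGammaDirectionDischarged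

end
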